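import Summits.QuantumFields.BalabanUV.T4Continuum.Support.NE7K1LinInvAntitone
import Literature.MathematicalPhysics.QuantumFieldTheory.Balaban1983to89.B4RandomWalk213

/-!
# NE7K1LinWalkParametrix — row NE7 (node U5), candidate route HOM, path H1L, cell K1-lin(s): B4 §2's RANDOM-WALK PARAMETRIX
# (2.2) ∕ (2.9)–(2.12) IN KERNEL for an ABSTRACT finite matrix — local operators, the parametrix identity `P·G₀ = 1 − R`,
# `G(1 − R) = G₀`, the exact truncated expansion, and the LOCALITY of the pieces

Lineage `b2b-balaban-t4-ne7-p2` (CRUX PROVER NE7 #2), generation 68; series (RW) file 1 (pure algebra, norm-free).  The tree's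
`Balaban1983to89.B4RandomWalk213` types B4's passage (2.12) → (2.13) → (2.30) ([Balaban1983RegularityDecay] = T. Bałaban, *Regularity
and decay of lattice Green's functions*, Commun. Math. Phys. 89 (1983) 571–597, pp. 575–581) as bookkeeping whose INPUTS — «the
parametrix identity (2.9)–(2.11), the bounds of Lemma 2.1 (2.15) and the smallness» — are hypotheses.  This file supplies the
first input for an ARBITRARY real matrix `P` on a finite index type: B4 p. 575 (2.2) *"G₀ = Σ_j h_jG_k(□_j,Ã_j)h_j"*, p. 576
(2.9)–(2.11) *"(−Δ^η_A + aQ*Q)G₀ = I − R, R = Σ_j K_jG_k(□_j,Ã_j)h_j"* and p. 577 (2.12) *"G_k(Ω,A) = G₀(I − R)^{−1} = Σ_n G₀R^n"*,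
with B4's cut-off pair `(h_j, h_j)` generalised to any pair `(l_j, r_j)` with `Σ_j l_j r_j ≡ 1` (B4: `l = r = h`, `Σh² = 1`):

* `locOp P S` — B4's local operator `G_k(□_j)^{−1}` made full-size: `P` compressed to `S × S` (the DIRICHLET compression: couplings
  leaving `S` are cut, the diagonal is kept) ⊕ the identity on `Sᶜ`; `locInv P S := (locOp P S)⁻¹`.  `locOp_form`, `locOp_coercive`
  (floor `min σ 1`), `locOp_isSymm`, `isUnit_det_locOp`, `locInv_supp` (sources supported in `S` give solutions supported in `S`),
  `locInv_sq_le` (`‖G_S g‖² ≤ ‖g‖²∕min(σ,1)²`), `locInv_energy_le` (`⟨G_S g, P(G_S g)⟩ ≤ ‖g‖²∕min(σ,1)` for `supp g ⊆ S`).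
* `diagonal_mul_eq_diagonal_mul_locOp` — CUT-OFF COMPATIBILITY: if `l` lives on `S` and `P` does not couple `supp l` to `Sᶜ`, then
  `diag(l)·P = diag(l)·locOp P S` (the *"obvious fact"* behind (2.9): on `supp h_j` the region operator IS the cube operator).
* **`parametrix_identity`** — `P · G₀ = 1 − R` with `G₀ = Σ_j diag(l_j)·G_j·diag(r_j)`, `R = Σ_j [diag(l_j), P]·G_j·diag(r_j)`
  (`G_j = locInv P (S j)`), for ANY finite family of triples `(l_j, r_j, S_j)` with the compatibility above and `Σ_j l_j(x)r_j(x) = 1`.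
* `inv_mul_one_sub_eq` — `P⁻¹(1 − R) = G₀` (B4 (2.12)'s algebra, `B4RandomWalk213.G_mul_one_sub_eq` BY NAME); **`inv_eq_sum_add_rem`**
  — the EXACT truncated expansion `P⁻¹ = Σ_{n<N} G₀Rⁿ + P⁻¹R^N` for every `N` (norm-free; the convergent series is file 3's).
* LOCALITY of the pieces `a j = diag(l_j)G_jdiag(r_j)`, `b j = [diag(l_j),P]G_jdiag(r_j)`: `a j * b k = 0 = b j * b k` whenever
  `S j ∩ S k = ∅` (`aPiece_mul_bPiece`, `bPiece_mul_bPiece` — the hypotheses `hab ∕ hbb` of `B4RandomWalk213.walk_decay_bound`), and the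
  support cut-offs `ind A * a j = 0`, `a j * ind B = 0 = b j * ind B` (`piece_cutoffs`; its `hP ∕ hP'a ∕ hP'b`).

HONEST FRAMING: [folklore] finite linear algebra; B4 §2's displays are quoted as the dictionary, nothing of Bałaban's is asserted; no
background field, no lattice yet (files 4–5 instantiate); no `sorry`.  Census: the random-walk half of cell K1-lin(s)'s «template
application» typed at the abstract level; NO letter ∕ tag ∕ size of NE7 moves; NE7 NOT PRINTED ∕ NOT PROVED; spine 0∕9; FIXED FINITE
T⁴, rung (B)+1; NOT infinite volume, NOT mass gap, NOT Clay.  HONEST DEPENDENCY: continuum YM on T⁴ ⇐ BetaPertH ∧ nine spine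
estimates (0/9 proved); BetaPertH ⇐ (D1) ∧ (D4) ∧ CAP+tail; G-an2-4 gates asym, D1 and NE2/3/4.
-/

noncomputable section

open Finset Matrix

namespace Summit.QuantumFields.BalabanUV.T4Continuum.NE7K1LinWalkParametrix

open NE7K1LinSchurLineForm NE7K1LinSchurLineDerivRel NE7K1LinInvAntitone
open Literature.MathematicalPhysics.QuantumFieldTheory.Balaban1983to89

variable {ι : Type*} [Fintype ι] [DecidableEq ι]

/-! ### §1 Local operators: the Dirichlet compression ⊕ identity, and its inverse -/

/-- **B4's LOCAL OPERATOR `G_k(□)^{−1}`, FULL-SIZE**: `P` compressed to `S × S` (couplings between `S` and its complement cut, diagonal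
kept — the Dirichlet restriction), and the identity on the complement of `S`. [cite: Balaban1983RegularityDecay, (2.2) p.575 «G_k(□_j,Ã_j)», dictionary] [folklore] -/
def locOp (P : Matrix ι ι ℝ) (S : Finset ι) : Matrix ι ι ℝ :=
  Matrix.of fun x y => if x ∈ S then (if y ∈ S then P x y else 0) else (if y = x then 1 else 0)

/-- the inverse of the local operator (B4's `G_k(□_j)` extended by the identity). [folklore] -/
def locInv (P : Matrix ι ι ℝ) (S : Finset ι) : Matrix ι ι ℝ := (locOp P S)⁻¹

/-- restriction of a vector to `S` (extension by zero outside). [folklore] -/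
def res (S : Finset ι) (v : ι → ℝ) : ι → ℝ := fun x => if x ∈ S then v x else 0

/-- the indicator-diagonal matrix `1_A`. [folklore] -/
def ind (A : Finset ι) : Matrix ι ι ℝ := diagonal fun x => if x ∈ A then 1 else 0

omit [Fintype ι] in
/-- entries of the local operator inside `S`. [folklore] -/
theorem locOp_apply_of_mem (P : Matrix ι ι ℝ) {S : Finset ι} {x : ι} (hx : x ∈ S) (y : ι) :
    locOp P S x y = if y ∈ S then P x y else 0 := by
  simp only [locOp, Matrix.of_apply, hx, if_true]

omit [Fintype ι] in
/-- entries of the local operator outside `S` (identity rows). [folklore] -/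
theorem locOp_apply_of_not_mem (P : Matrix ι ι ℝ) {S : Finset ι} {x : ι} (hx : x ∉ S) (y : ι) :
    locOp P S x y = if y = x then 1 else 0 := by
  simp only [locOp, Matrix.of_apply, hx, if_false]

/-- the local operator applied to a vector: `P` on the restriction inside `S`, the identity outside. [folklore] -/
theorem locOp_mulVec (P : Matrix ι ι ℝ) (S : Finset ι) (v : ι → ℝ) (x : ι) :
    (locOp P S *ᵥ v) x = if x ∈ S then (P *ᵥ res S v) x else v x := by
  simp only [mulVec, dotProduct]
  by_cases hx : x ∈ S
  · simp only [hx, if_true, locOp_apply_of_mem P hx, res]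
    refine Finset.sum_congr rfl fun y _ => ?_
    by_cases hy : y ∈ S <;> simp [hy]
  · simp only [hx, if_false, locOp_apply_of_not_mem P hx]
    rw [Finset.sum_eq_single x (fun y _ hyx => by simp [hyx]) (fun h => absurd (Finset.mem_univ x) h)]
    simp

/-- `P` applied to a restricted vector, read inside `S`, only sees entries of `P` in `S × S`. [folklore] -/
theorem mulVec_res_apply (P : Matrix ι ι ℝ) (S : Finset ι) (v : ι → ℝ) (x : ι) :
    (P *ᵥ res S v) x = ∑ y ∈ S, P x y * v y := by
  classical
  simp only [mulVec, dotProduct, res, mul_ite, mul_zero]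
  rw [← Finset.sum_filter]
  exact Finset.sum_congr (by ext y; simp) fun _ _ => rfl

/-- **THE FORM OF THE LOCAL OPERATOR**: `⟨v, locOp P S v⟩ = ⟨res_S v, P res_S v⟩ + Σ_{x ∉ S} v_x²`. [folklore] -/
theorem locOp_form (P : Matrix ι ι ℝ) (S : Finset ι) (v : ι → ℝ) :
    v ⬝ᵥ locOp P S *ᵥ v = res S v ⬝ᵥ P *ᵥ res S v + ∑ x ∈ univ.filter (fun x => x ∉ S), v x * v x := by
  have h1 : v ⬝ᵥ locOp P S *ᵥ v = ∑ x, (if x ∈ S then v x * (P *ᵥ res S v) x else v x * v x) := by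
    simp only [dotProduct, locOp_mulVec]
    exact Finset.sum_congr rfl fun x _ => by split_ifs <;> rfl
  have h2 : res S v ⬝ᵥ P *ᵥ res S v = ∑ x, (if x ∈ S then v x * (P *ᵥ res S v) x else 0) := by
    simp only [dotProduct]
    exact Finset.sum_congr rfl fun x _ => by unfold res; split_ifs <;> simp
  rw [h1, h2, Finset.sum_filter, ← Finset.sum_add_distrib]
  exact Finset.sum_congr rfl fun x _ => by split_ifs <;> simp

/-- the restriction does not increase the norm. [folklore] -/
theorem res_dot_res_le (S : Finset ι) (v : ι → ℝ) : res S v ⬝ᵥ res S v ≤ v ⬝ᵥ v :=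
  Finset.sum_le_sum fun x _ => by unfold res; split_ifs <;> nlinarith [mul_self_nonneg (v x)]

/-- the norm splits into the part inside `S` and the part outside. [folklore] -/
theorem dot_eq_res_add (S : Finset ι) (v : ι → ℝ) :
    v ⬝ᵥ v = res S v ⬝ᵥ res S v + ∑ x ∈ univ.filter (fun x => x ∉ S), v x * v x := by
  have h2 : res S v ⬝ᵥ res S v = ∑ x, (if x ∈ S then v x * v x else 0) := by
    simp only [dotProduct]
    exact Finset.sum_congr rfl fun x _ => by unfold res; split_ifs <;> simp
  rw [h2, Finset.sum_filter, ← Finset.sum_add_distrib]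
  exact Finset.sum_congr rfl fun x _ => by split_ifs <;> simp

/-- **THE LOCAL OPERATOR IS COERCIVE** with floor `min σ 1` when `P` is `σ`-coercive (the compression inherits the floor, the identity
rows have floor 1). [cite: Balaban1983RegularityDecay, p.573 (1.8) «γ₀ independent … of Ω», dictionary] [folklore] -/
theorem locOp_coercive (P : Matrix ι ι ℝ) {σ : ℝ} (hPc : ∀ w, σ * (w ⬝ᵥ w) ≤ w ⬝ᵥ P *ᵥ w) (S : Finset ι) (v : ι → ℝ) :
    min σ 1 * (v ⬝ᵥ v) ≤ v ⬝ᵥ locOp P S *ᵥ v := by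
  rw [locOp_form, dot_eq_res_add S v, mul_add]
  have h1 : min σ 1 * (res S v ⬝ᵥ res S v) ≤ res S v ⬝ᵥ P *ᵥ res S v :=
    (mul_le_mul_of_nonneg_right (min_le_left σ 1)
      (Finset.sum_nonneg fun x _ => mul_self_nonneg _)).trans (hPc _)
  have h2 : min σ 1 * ∑ x ∈ univ.filter (fun x => x ∉ S), v x * v x ≤ ∑ x ∈ univ.filter (fun x => x ∉ S), v x * v x := by
    have h0 : 0 ≤ ∑ x ∈ univ.filter (fun x => x ∉ S), v x * v x := Finset.sum_nonneg fun x _ => mul_self_nonneg _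
    nlinarith [min_le_right σ 1]
  exact add_le_add h1 h2

omit [Fintype ι] in
/-- the local operator of a symmetric matrix is symmetric. [folklore] -/
theorem locOp_isSymm {P : Matrix ι ι ℝ} (hP : P.IsSymm) (S : Finset ι) : (locOp P S).IsSymm := by
  ext x y
  simp only [transpose_apply, locOp, Matrix.of_apply]
  by_cases hx : x ∈ S <;> by_cases hy : y ∈ S <;> simp only [hx, hy, if_true, if_false]
  · exact hP.apply x y
  · have : x ≠ y := fun h => hy (h ▸ hx)
    simp [this]
  · have : y ≠ x := fun h => hx (h ▸ hy)
    simp [this]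
  · by_cases h : x = y
    · subst h; simp
    · simp [h, Ne.symm h]

/-- the local operator of a coercive matrix is invertible. [folklore] -/
theorem isUnit_det_locOp (P : Matrix ι ι ℝ) {σ : ℝ} (hσ : 0 < σ) (hPc : ∀ w, σ * (w ⬝ᵥ w) ≤ w ⬝ᵥ P *ᵥ w) (S : Finset ι) :
    IsUnit (locOp P S).det :=
  isUnit_det_of_coercive _ (lt_min hσ one_pos) (locOp_coercive P hPc S)

/-- `locOp · locInv = 1`. [folklore] -/
theorem locOp_mul_locInv (P : Matrix ι ι ℝ) {σ : ℝ} (hσ : 0 < σ) (hPc : ∀ w, σ * (w ⬝ᵥ w) ≤ w ⬝ᵥ P *ᵥ w) (S : Finset ι) :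
    locOp P S * locInv P S = 1 :=
  mul_nonsing_inv _ (isUnit_det_locOp P hσ hPc S)

/-- `locInv · locOp = 1`. [folklore] -/
theorem locInv_mul_locOp (P : Matrix ι ι ℝ) {σ : ℝ} (hσ : 0 < σ) (hPc : ∀ w, σ * (w ⬝ᵥ w) ≤ w ⬝ᵥ P *ᵥ w) (S : Finset ι) :
    locInv P S * locOp P S = 1 :=
  nonsing_inv_mul _ (isUnit_det_locOp P hσ hPc S)

/-- **SUPPORT**: a source supported in `S` has its local solution supported in `S` (the identity rows). [folklore] -/
theorem locInv_supp (P : Matrix ι ι ℝ) {σ : ℝ} (hσ : 0 < σ) (hPc : ∀ w, σ * (w ⬝ᵥ w) ≤ w ⬝ᵥ P *ᵥ w) (S : Finset ι)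
    {g : ι → ℝ} (hg : ∀ x, x ∉ S → g x = 0) {x : ι} (hx : x ∉ S) : (locInv P S *ᵥ g) x = 0 := by
  have h := congrFun (congrArg (fun M => M *ᵥ g) (locOp_mul_locInv P hσ hPc S)) x
  simp only [← mulVec_mulVec, one_mulVec] at h
  rw [locOp_mulVec, if_neg hx] at h
  rw [h, hg x hx]

omit [Fintype ι] in
/-- a vector supported in `S` is its own restriction. [folklore] -/
theorem res_eq_self_of_supp (S : Finset ι) {v : ι → ℝ} (hv : ∀ x, x ∉ S → v x = 0) : res S v = v := by
  funext x; unfold res; split_ifs with h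
  · rfl
  · exact (hv x h).symm

/-- on vectors supported in `S`, the form of the local operator IS the form of `P`. [folklore] -/
theorem locOp_form_of_supp (P : Matrix ι ι ℝ) (S : Finset ι) {v : ι → ℝ} (hv : ∀ x, x ∉ S → v x = 0) :
    v ⬝ᵥ locOp P S *ᵥ v = v ⬝ᵥ P *ᵥ v := by
  rw [locOp_form, res_eq_self_of_supp S hv]
  have : ∑ x ∈ univ.filter (fun x => x ∉ S), v x * v x = 0 :=
    Finset.sum_eq_zero fun x hx => by rw [hv x (Finset.mem_filter.mp hx).2, mul_zero]
  rw [this, add_zero]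

/-- **L² BOUND OF THE LOCAL INVERSE**: `‖G_S g‖² ≤ ‖g‖²∕min(σ,1)²` and `⟨G_S g, g⟩ ≤ ‖g‖²∕min(σ,1)` (Lemma 2.1's first L²-bound, at
the abstract level: coercivity alone). [cite: Balaban1983RegularityDecay, Lemma 2.1 (2.15) p.577, shape] [folklore] -/
theorem locInv_sq_le (P : Matrix ι ι ℝ) {σ : ℝ} (hσ : 0 < σ) (hPc : ∀ w, σ * (w ⬝ᵥ w) ≤ w ⬝ᵥ P *ᵥ w) (S : Finset ι)
    (g : ι → ℝ) :
    locInv P S *ᵥ g ⬝ᵥ g ≤ (g ⬝ᵥ g) / min σ 1 ∧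
      locInv P S *ᵥ g ⬝ᵥ locInv P S *ᵥ g ≤ (g ⬝ᵥ g) / (min σ 1) ^ 2 := by
  set u := locInv P S *ᵥ g with hu
  have hσ' : 0 < min σ 1 := lt_min hσ one_pos
  have hLu : locOp P S *ᵥ u = g := by
    rw [hu, mulVec_mulVec, locOp_mul_locInv P hσ hPc S, one_mulVec]
  have hc : min σ 1 * (u ⬝ᵥ u) ≤ u ⬝ᵥ g := by rw [← hLu]; exact locOp_coercive P hPc S u
  exact dot_le_of_coercive_pair hσ' u g hc

/-- **ENERGY BOUND OF THE LOCAL SOLUTION**: for a source `g` supported in `S`, the solution `v = G_S g` is supported in `S`, solves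
`⟨v, Pv⟩ = ⟨v, g⟩`, hence `⟨v, Pv⟩ ≤ ‖g‖²∕min(σ,1)` (the energy input of Lemma 2.1's gradient bounds). [folklore] -/
theorem locInv_energy_le (P : Matrix ι ι ℝ) {σ : ℝ} (hσ : 0 < σ) (hPc : ∀ w, σ * (w ⬝ᵥ w) ≤ w ⬝ᵥ P *ᵥ w) (S : Finset ι)
    {g : ι → ℝ} (hg : ∀ x, x ∉ S → g x = 0) :
    locInv P S *ᵥ g ⬝ᵥ P *ᵥ (locInv P S *ᵥ g) = locInv P S *ᵥ g ⬝ᵥ g ∧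
      locInv P S *ᵥ g ⬝ᵥ P *ᵥ (locInv P S *ᵥ g) ≤ (g ⬝ᵥ g) / min σ 1 := by
  set u := locInv P S *ᵥ g with hu
  have hLu : locOp P S *ᵥ u = g := by
    rw [hu, mulVec_mulVec, locOp_mul_locInv P hσ hPc S, one_mulVec]
  have hsupp : ∀ x, x ∉ S → u x = 0 := fun x hx => locInv_supp P hσ hPc S hg hx
  have he : u ⬝ᵥ P *ᵥ u = u ⬝ᵥ g := by rw [← locOp_form_of_supp P S hsupp, hLu]
  exact ⟨he, he ▸ (locInv_sq_le P hσ hPc S g).1⟩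

/-! ### §2 Cut-off compatibility and the parametrix identity (2.9)–(2.11) -/

/-- **A CUT-OFF LIVES ON `S` FOR `P`**: `l` vanishes off `S` and `P` does not couple `supp l` to the complement of `S` (in either
index order) — B4's «supp h_j ⊂ □̃_j, well inside □_j, range of the operator ≪ the margin». [folklore] -/
def CutoffOn (P : Matrix ι ι ℝ) (l : ι → ℝ) (S : Finset ι) : Prop :=
  (∀ x, l x ≠ 0 → x ∈ S) ∧ (∀ x y, l x ≠ 0 → y ∉ S → P x y = 0 ∧ P y x = 0)

omit [Fintype ι] [DecidableEq ι] in
/-- the support clause of `CutoffOn`. [folklore] -/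
theorem CutoffOn.supp {P : Matrix ι ι ℝ} {l : ι → ℝ} {S : Finset ι} (h : CutoffOn P l S) (x : ι) (hx : l x ≠ 0) :
    x ∈ S := h.1 x hx

omit [Fintype ι] [DecidableEq ι] in
/-- the interior clause of `CutoffOn`. [folklore] -/
theorem CutoffOn.interior {P : Matrix ι ι ℝ} {l : ι → ℝ} {S : Finset ι} (h : CutoffOn P l S) (x y : ι) (hx : l x ≠ 0)
    (hy : y ∉ S) : P x y = 0 ∧ P y x = 0 := h.2 x y hx hy

omit [Fintype ι] [DecidableEq ι] in
/-- a cut-off vanishes outside its region. [folklore] -/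
theorem CutoffOn.eq_zero {P : Matrix ι ι ℝ} {l : ι → ℝ} {S : Finset ι} (h : CutoffOn P l S) {x : ι} (hx : x ∉ S) :
    l x = 0 := by
  by_contra hl; exact hx (h.supp x hl)

/-- **CUT-OFF COMPATIBILITY** (the «obvious fact» behind (2.9)): `diag(l)·P = diag(l)·locOp P S`. [cite: Balaban1983RegularityDecay, (2.9)–(2.11) p.576, mechanism] [folklore] -/
theorem diagonal_mul_eq_diagonal_mul_locOp {P : Matrix ι ι ℝ} {l : ι → ℝ} {S : Finset ι} (h : CutoffOn P l S) :
    diagonal l * P = diagonal l * locOp P S := by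
  ext x y
  simp only [diagonal_mul]
  by_cases hl : l x = 0
  · simp [hl]
  · have hx : x ∈ S := h.supp x hl
    rw [locOp_apply_of_mem P hx]
    by_cases hy : y ∈ S
    · simp [hy]
    · simp [hy, (h.interior x y hl hy).1]

/-- the commutator `[diag(l), P] = diag(l)·P − P·diag(l)` (B4's `K_j`, up to sign and the identification with `[−Δ, h_j]`). [folklore] -/
def comm (l : ι → ℝ) (P : Matrix ι ι ℝ) : Matrix ι ι ℝ := diagonal l * P - P * diagonal l

/-- entries of the commutator: `(l_x − l_y)·P_xy`. [folklore] -/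
theorem comm_apply (l : ι → ℝ) (P : Matrix ι ι ℝ) (x y : ι) : comm l P x y = (l x - l y) * P x y := by
  rw [comm, Matrix.sub_apply, diagonal_mul, mul_diagonal]; ring

/-- the parametrix piece `a_j = diag(l_j)·G_j·diag(r_j)` (B4's `h_jG_k(□_j)h_j`). [cite: Balaban1983RegularityDecay, (2.2) p.575, dictionary] [folklore] -/
def aPiece (P : Matrix ι ι ℝ) (l r : ι → ℝ) (S : Finset ι) : Matrix ι ι ℝ := diagonal l * locInv P S * diagonal r

/-- the remainder piece `b_j = [diag(l_j),P]·G_j·diag(r_j)` (B4's `K_jG_k(□_j)h_j`, sign absorbed). [cite: Balaban1983RegularityDecay, (2.11) p.576, dictionary] [folklore] -/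
def bPiece (P : Matrix ι ι ℝ) (l r : ι → ℝ) (S : Finset ι) : Matrix ι ι ℝ := comm l P * locInv P S * diagonal r

/-- one summand of (2.9): `P·(diag(l)·G_S·diag(r)) = diag(l)·diag(r) − [diag(l),P]·G_S·diag(r)`. [folklore] -/
theorem mul_aPiece (P : Matrix ι ι ℝ) {σ : ℝ} (hσ : 0 < σ) (hPc : ∀ w, σ * (w ⬝ᵥ w) ≤ w ⬝ᵥ P *ᵥ w) {l : ι → ℝ} (r : ι → ℝ)
    {S : Finset ι} (h : CutoffOn P l S) :
    P * aPiece P l r S = diagonal (fun x => l x * r x) - bPiece P l r S := by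
  have key : P * diagonal l = diagonal l * locOp P S - comm l P := by
    rw [comm, ← diagonal_mul_eq_diagonal_mul_locOp h]; abel
  calc P * aPiece P l r S = (P * diagonal l) * locInv P S * diagonal r := by
        simp only [aPiece, Matrix.mul_assoc]
    _ = (diagonal l * locOp P S - comm l P) * locInv P S * diagonal r := by rw [key]
    _ = diagonal l * (locOp P S * locInv P S) * diagonal r - comm l P * locInv P S * diagonal r := by
        simp only [Matrix.sub_mul, Matrix.mul_assoc]
    _ = diagonal (fun x => l x * r x) - bPiece P l r S := by
        rw [locOp_mul_locInv P hσ hPc S, Matrix.mul_one, diagonal_mul_diagonal, bPiece]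

/-- **THE PARAMETRIX IDENTITY (2.9)–(2.11)**: for any finite family of cut-off triples `(l_j, r_j, S_j)` with each `l_j` living on
`S_j` for `P` and `Σ_j l_j(x)·r_j(x) = 1` at every `x`:  `P · (Σ_j diag(l_j)·G_j·diag(r_j)) = 1 − Σ_j [diag(l_j),P]·G_j·diag(r_j)`.
B4: `l_j = r_j = h_j`, `Σ_j h_j² = 1`, *"(−Δ^η_A + aQ*_kQ_k)G₀ = I − R"*. [cite: Balaban1983RegularityDecay, (2.9)–(2.11) p.576] [folklore] -/
theorem parametrix_identity {J : Type*} [Fintype J] (P : Matrix ι ι ℝ) {σ : ℝ} (hσ : 0 < σ)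
    (hPc : ∀ w, σ * (w ⬝ᵥ w) ≤ w ⬝ᵥ P *ᵥ w) (l r : J → ι → ℝ) (S : J → Finset ι)
    (hcut : ∀ j, CutoffOn P (l j) (S j)) (hpu : ∀ x, ∑ j, l j x * r j x = 1) :
    P * ∑ j, aPiece P (l j) (r j) (S j) = 1 - ∑ j, bPiece P (l j) (r j) (S j) := by
  rw [Finset.mul_sum]
  simp only [mul_aPiece P hσ hPc _ (hcut _), Finset.sum_sub_distrib]
  congr 1
  ext x y
  simp only [Matrix.sum_apply, diagonal_apply, one_apply]
  split_ifs with h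
  · subst h; exact hpu x
  · simp

/-- `P⁻¹·(1 − R) = G₀` — the algebra of (2.12) BY NAME (`B4RandomWalk213.G_mul_one_sub_eq`). [cite: Balaban1983RegularityDecay, (2.12) p.577] [folklore] -/
theorem inv_mul_one_sub_eq {J : Type*} [Fintype J] (P : Matrix ι ι ℝ) {σ : ℝ} (hσ : 0 < σ)
    (hPc : ∀ w, σ * (w ⬝ᵥ w) ≤ w ⬝ᵥ P *ᵥ w) (l r : J → ι → ℝ) (S : J → Finset ι)
    (hcut : ∀ j, CutoffOn P (l j) (S j)) (hpu : ∀ x, ∑ j, l j x * r j x = 1) :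
    P⁻¹ * (1 - ∑ j, bPiece P (l j) (r j) (S j)) = ∑ j, aPiece P (l j) (r j) (S j) :=
  B4RandomWalk213.G_mul_one_sub_eq (nonsing_inv_mul P (isUnit_det_of_coercive P hσ hPc))
    (parametrix_identity P hσ hPc l r S hcut hpu)

omit [DecidableEq ι] in
/-- the truncated Neumann expansion, abstractly: `G(1 − R) = G₀ ⇒ G = Σ_{n<N} G₀Rⁿ + G·R^N` in any ring. [folklore] -/
theorem eq_sum_add_rem {A : Type*} [Ring A] {G G₀ Rop : A} (h : G * (1 - Rop) = G₀) (N : ℕ) :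
    G = ∑ n ∈ Finset.range N, G₀ * Rop ^ n + G * Rop ^ N := by
  induction N with
  | zero => simp
  | succ N ih =>
    rw [Finset.sum_range_succ, add_assoc]
    have : G₀ * Rop ^ N + G * Rop ^ (N + 1) = G * Rop ^ N := by
      rw [← h, pow_succ']; noncomm_ring
    rw [this]; exact ih

/-- **THE EXACT TRUNCATED RANDOM-WALK EXPANSION**: `P⁻¹ = Σ_{n<N} G₀Rⁿ + P⁻¹·R^N` for EVERY `N` (B4 (2.12) cut at order `N`, with
the remainder displayed; no norm, no convergence needed). [cite: Balaban1983RegularityDecay, (2.12) p.577] [folklore] -/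
theorem inv_eq_sum_add_rem {J : Type*} [Fintype J] (P : Matrix ι ι ℝ) {σ : ℝ} (hσ : 0 < σ)
    (hPc : ∀ w, σ * (w ⬝ᵥ w) ≤ w ⬝ᵥ P *ᵥ w) (l r : J → ι → ℝ) (S : J → Finset ι)
    (hcut : ∀ j, CutoffOn P (l j) (S j)) (hpu : ∀ x, ∑ j, l j x * r j x = 1) (N : ℕ) :
    P⁻¹ = ∑ n ∈ Finset.range N, (∑ j, aPiece P (l j) (r j) (S j)) * (∑ j, bPiece P (l j) (r j) (S j)) ^ n
      + P⁻¹ * (∑ j, bPiece P (l j) (r j) (S j)) ^ N :=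
  eq_sum_add_rem (inv_mul_one_sub_eq P hσ hPc l r S hcut hpu) N

/-! ### §3 Locality of the pieces (the hypotheses of `B4RandomWalk213.walk_decay_bound`) -/

/-- the row support of the commutator: `[diag(l),P]_{xy} ≠ 0 ⇒ x ∈ S` when `l` lives on `S` for `P`. [folklore] -/
theorem comm_apply_eq_zero_of_not_mem {P : Matrix ι ι ℝ} {l : ι → ℝ} {S : Finset ι} (h : CutoffOn P l S) {x : ι}
    (hx : x ∉ S) (y : ι) : comm l P x y = 0 := by
  rw [comm_apply, h.eq_zero hx, zero_sub, neg_mul, neg_eq_zero]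
  by_cases hly : l y = 0
  · rw [hly, zero_mul]
  · rw [(h.interior y x hly hx).2, mul_zero]

/-- a diagonal supported off `S` kills the commutator from the left: `diag(r')·[diag(l),P] = 0` if `r' = 0` on `S`. [folklore] -/
theorem diagonal_mul_comm_eq_zero {P : Matrix ι ι ℝ} {l : ι → ℝ} {S : Finset ι} (h : CutoffOn P l S) {r' : ι → ℝ}
    (hr' : ∀ x, x ∈ S → r' x = 0) : diagonal r' * comm l P = 0 := by
  ext x y
  rw [diagonal_mul, Matrix.zero_apply]
  by_cases hx : x ∈ S
  · rw [hr' x hx, zero_mul]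
  · rw [comm_apply_eq_zero_of_not_mem h hx, mul_zero]

/-- **LOCALITY `a_j · b_k = 0`** for disjoint regions (`supp r_j ⊆ S_j`, `l_k` on `S_k`, `S_j ∩ S_k = ∅`) — hypothesis `hab` of
`B4RandomWalk213.walk_decay_bound` (B4 p. 577: *"the obvious fact that G_k(□_j)h_jK_{j'}G_k(□_{j'}) = 0, if |j − j'| > 1"*).
[cite: Balaban1983RegularityDecay, (2.13) p.577] [folklore] -/
theorem aPiece_mul_bPiece (P : Matrix ι ι ℝ) {lj rj lk rk : ι → ℝ} {Sj Sk : Finset ι} (hrj : ∀ x, rj x ≠ 0 → x ∈ Sj)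
    (hk : CutoffOn P lk Sk) (hdisj : Disjoint Sj Sk) : aPiece P lj rj Sj * bPiece P lk rk Sk = 0 := by
  have hz : diagonal rj * comm lk P = 0 :=
    diagonal_mul_comm_eq_zero hk fun x hx => by
      by_contra h; exact Finset.disjoint_left.mp hdisj (hrj x h) hx
  calc aPiece P lj rj Sj * bPiece P lk rk Sk
      = diagonal lj * locInv P Sj * (diagonal rj * comm lk P) * locInv P Sk * diagonal rk := by
        simp only [aPiece, bPiece, Matrix.mul_assoc]
    _ = 0 := by rw [hz]; simp

/-- **LOCALITY `b_j · b_k = 0`** for disjoint regions — hypothesis `hbb` of `walk_decay_bound`. [cite: Balaban1983RegularityDecay, (2.13) p.577] [folklore] -/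
theorem bPiece_mul_bPiece (P : Matrix ι ι ℝ) {lj rj lk rk : ι → ℝ} {Sj Sk : Finset ι} (hrj : ∀ x, rj x ≠ 0 → x ∈ Sj)
    (hk : CutoffOn P lk Sk) (hdisj : Disjoint Sj Sk) : bPiece P lj rj Sj * bPiece P lk rk Sk = 0 := by
  have hz : diagonal rj * comm lk P = 0 :=
    diagonal_mul_comm_eq_zero hk fun x hx => by
      by_contra h; exact Finset.disjoint_left.mp hdisj (hrj x h) hx
  calc bPiece P lj rj Sj * bPiece P lk rk Sk
      = comm lj P * locInv P Sj * (diagonal rj * comm lk P) * locInv P Sk * diagonal rk := by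
        simp only [bPiece, Matrix.mul_assoc]
    _ = 0 := by rw [hz]; simp

/-- `1_A · diag(l) = 0` when `l` vanishes on `A` (and symmetrically). [folklore] -/
theorem ind_mul_diagonal_eq_zero {l : ι → ℝ} {A : Finset ι} (hA : ∀ x, x ∈ A → l x = 0) :
    ind A * diagonal l = 0 ∧ diagonal l * ind A = 0 := by
  have h : (fun x => (if x ∈ A then (1 : ℝ) else 0) * l x) = 0 := by
    funext x; by_cases hx : x ∈ A
    · simp [hx, hA x hx]
    · simp [hx]
  have h' : (fun x => l x * if x ∈ A then (1 : ℝ) else 0) = 0 := by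
    rw [← h]; funext x; ring
  simp only [ind, diagonal_mul_diagonal, h, h']
  exact ⟨diagonal_zero, diagonal_zero⟩

/-- support cut-offs: `1_A · a_j = 0` when `l_j` vanishes on `A`; `a_j · 1_B = 0 = b_j · 1_B` when `r_j` vanishes on `B` —
hypotheses `hP`, `hP'a`, `hP'b` of `B4RandomWalk213.walk_decay_bound`. [folklore] -/
theorem piece_cutoffs (P : Matrix ι ι ℝ) {l r : ι → ℝ} {S A B : Finset ι} (hA : ∀ x, x ∈ A → l x = 0)
    (hB : ∀ x, x ∈ B → r x = 0) :
    ind A * aPiece P l r S = 0 ∧ aPiece P l r S * ind B = 0 ∧ bPiece P l r S * ind B = 0 := by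
  refine ⟨?_, ?_, ?_⟩
  · rw [aPiece, ← Matrix.mul_assoc, ← Matrix.mul_assoc, (ind_mul_diagonal_eq_zero hA).1]; simp
  · rw [aPiece, Matrix.mul_assoc, (ind_mul_diagonal_eq_zero hB).2]; simp
  · rw [bPiece, Matrix.mul_assoc, (ind_mul_diagonal_eq_zero hB).2]; simp

end Summit.QuantumFields.BalabanUV.T4Continuum.NE7K1LinWalkParametrix

end
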